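import Literature.Analysis.FluidPDE.TorusClassicalLerayHopfProofs
import Literature.Analysis.FluidPDE.LongTimeAveragePeriodic

/-!
# Route DopplerClock (AnomalousDissipation) — crux `QuadratureStressFloor` (stmt-AnomalousDissipation-18129),
# line `laminar-burst-shadowing`: the registered stub `stub_periodicDriftBookkeeping`

Sorry-free discharge of the bookkeeping stub of the line `laminar-burst-shadowing` (payload slug `Sketch`)
for the crux `Summit.AnomalousDissipation.AnomalousDissipation.Theses.DopplerClock.QuadratureStressFloor`.
A `τ`-periodic (`τ > 0`) global classical solution `(u, p)` of the Navier–Stokes system `NS_ν` on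
`ℝ × 𝕋³` under a STEADY force `f`

* is a global Leray–Hopf solution from `u 0` (`Torus.IsClassicalNSSolutionOn.isGlobalLerayHopf`,
  Robinson–Rodrigo–Sadowski 2016, Thm. 6.5);
* has `sup_t ½‖u(t)‖₂² < ∞`: `t ↦ ½‖u(t)‖₂²` is continuous (joint smoothness,
  `Torus.IsSmoothSpaceTimeOn.continuousOn_integral`) and `τ`-periodic, hence bounded by its bound on
  the compact period `[0, τ]` (`PeriodicDriftBookkeeping.exists_kineticEnergy_le`, every time being
  congruent to one in `[0, τ)`, `Function.Periodic.exists_mem_Ico₀`);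
* satisfies the NO-LEAK CLAUSE WITH EQUALITY `⟨(f, u)⟩⁺ = ⟨ν‖∇u‖₂²⟩`: both long-time averages are
  averages of `τ`-periodic observables, hence period averages (`longTimeAvgSup_eq_of_periodic`,
  `meanDissipation_eq_of_periodic`; Cheskidov 2023, §6), and the energy equality over one period
  (`Torus.IsClassicalNSSolutionOn.energy_eq` with `E(u(τ)) = E(u(0))`) is the period work identity
  `ν ∫₀^τ ‖∇u‖₂² = ∫₀^τ (f, u)` (`PeriodicDriftBookkeeping.intervalIntegral_inner_eq_of_periodic`),
  the classical and the spectral squared gradient norms agreeing on the smooth slices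
  (`Torus.gradNormSq_eq_toReal_eGradNormSq_holds`);
* gives every generalized (Banach) limit the same injection, `Λ⟨(f, u)⟩ = ⟨ν‖∇u‖₂²⟩`
  (`GeneralizedLimit.longTimeAvg_eq_of_periodic`; Doering–Foias 2002, §2: `Lim` extends `lim`).

The helpers in `namespace PeriodicDriftBookkeeping` are stated in every dimension `d` and for
time-dependent forces where this costs nothing; the registered stub (the last theorem, verbatim
signature) is the case `d = Fin 3`, steady force. Its hypothesis `0 < ν` is not used. No new
definitions; nothing about the loud witnesses of the line (the core stub) is proved here.

References: J. C. Robinson, J. L. Rodrigo, W. Sadowski, *The Three-Dimensional Navier–Stokes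
Equations*, CUP 2016, Thm. 6.5; C. R. Doering, C. Foias, *Energy dissipation in body-forced
turbulence*, J. Fluid Mech. 467 (2002), §2; A. Cheskidov, *Dissipation anomaly and anomalous
dissipation in incompressible fluid flows*, arXiv:2311.04182 (2023), §6.
-/

noncomputable section

-- `Summit.<Summit>.<Problem>` is the tree's mandated summit-side namespace (CONVENTIONS §2); for this
-- single-conjunct summit the two coincide, so the duplicate is deliberate.
set_option linter.dupNamespace false

open MeasureTheory Set Filter Topology
open scoped InnerProductSpace RealInnerProductSpace

namespace Summit.AnomalousDissipation.AnomalousDissipation.Theorems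

open Literature.Analysis.FluidPDE Literature.Analysis.FluidPDE.Torus
open Literature.Analysis.FunctionSpaces Literature.Analysis.FunctionSpaces.Torus

namespace PeriodicDriftBookkeeping

variable {d : Type*} [Fintype d]

/-- **Continuity of the kinetic energy in time**: for a jointly smooth field `u` on `ℝ × T^d`,
`t ↦ ½‖u(t)‖₂²` is continuous (the space integral of the jointly smooth `‖u‖²`,
`Torus.IsSmoothSpaceTimeOn.continuousOn_integral`). [folklore] -/
theorem continuous_kineticEnergy {u : ℝ → UnitAddTorus d → EuclideanSpace ℝ d}
    (hu : IsSmoothSpaceTimeOn univ u) : Continuous fun t => kineticEnergy (u t) := by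
  have h : ContinuousOn (fun t => ∫ x, ‖u t x‖ ^ 2) univ :=
    hu.normSq.continuousOn_integral convex_univ
  show Continuous fun t => 2⁻¹ * ∫ x, ‖u t x‖ ^ 2
  exact continuous_const.mul (continuousOn_univ.1 h)

/-- **Uniform energy bound for time-periodic smooth fields**: if `u` is jointly smooth on
`ℝ × T^d` and `τ`-periodic in time (`τ > 0`), then `sup_t ½‖u(t)‖₂² < ∞` (every time is
congruent to one in `[0, τ)`, `Function.Periodic.exists_mem_Ico₀`, and the continuous energy is
bounded on the compact `[0, τ]`). [folklore] -/
theorem exists_kineticEnergy_le {u : ℝ → UnitAddTorus d → EuclideanSpace ℝ d}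
    (hu : IsSmoothSpaceTimeOn univ u) {τ : ℝ} (hper : Function.Periodic u τ) (hτ : 0 < τ) :
    ∃ C : ℝ, ∀ t : ℝ, kineticEnergy (u t) ≤ C := by
  obtain ⟨C, hC⟩ := isCompact_Icc.exists_bound_of_continuousOn
    ((continuous_kineticEnergy hu).continuousOn (s := Icc 0 τ))
  refine ⟨C, fun t => ?_⟩
  obtain ⟨s, hs, hts⟩ := hper.exists_mem_Ico₀ hτ t
  rw [hts]
  exact (Real.le_norm_self _).trans (hC s (Ico_subset_Icc_self hs))

variable [DecidableEq d]

/-- **Period work identity** for a `τ`-periodic classical solution of the forced Navier–Stokes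
system on `ℝ × T^d` (`τ ≥ 0`): `∫₀^τ (f, u) dt = ν ∫₀^τ ‖∇u(t)‖₂² dt` — the energy equality
`½‖u(τ)‖² + ν ∫₀^τ ‖∇u‖² = ½‖u(0)‖² + ∫₀^τ (f, u)` (Robinson–Rodrigo–Sadowski 2016, Thm. 6.5;
Doering–Foias 2002, §2, (2.4) integrated in time) together with `u(τ) = u(0)`. [folklore] -/
theorem intervalIntegral_inner_eq_of_periodic {ν : ℝ}
    {f u : ℝ → UnitAddTorus d → EuclideanSpace ℝ d} {p : ℝ → UnitAddTorus d → ℝ}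
    (h : IsClassicalNSSolutionOn univ ν f u p) {τ : ℝ} (hper : Function.Periodic u τ)
    (hτ : 0 ≤ τ) :
    ∫ t in (0 : ℝ)..τ, ∫ x, ⟪f t x, u t x⟫ = ν * ∫ t in (0 : ℝ)..τ, gradNormSq (u t) := by
  have hE := h.energy_eq convex_univ hτ (subset_univ _)
  have h0 : u τ = u 0 := by simpa using hper 0
  rw [h0] at hE
  linarith

/-- **Period work identity, spectral form**: for a `τ`-periodic classical solution on `ℝ × T^d`
(`τ ≥ 0`), `∫₀^τ (f, u) dt = ∫₀^τ ν‖∇u(t)‖₂² dt` with the spectral squared gradient norm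
`Torus.eGradNormSq` of `meanDissipation`, which agrees with the classical one on the smooth slices
(`Torus.gradNormSq_eq_toReal_eGradNormSq_holds`). [folklore] -/
theorem intervalIntegral_inner_eq_dissipation_of_periodic {ν : ℝ}
    {f u : ℝ → UnitAddTorus d → EuclideanSpace ℝ d} {p : ℝ → UnitAddTorus d → ℝ}
    (h : IsClassicalNSSolutionOn univ ν f u p) {τ : ℝ} (hper : Function.Periodic u τ)
    (hτ : 0 ≤ τ) :
    ∫ t in (0 : ℝ)..τ, ∫ x, ⟪f t x, u t x⟫ =
      ∫ t in (0 : ℝ)..τ, ν * (eGradNormSq (u t)).toReal := by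
  rw [intervalIntegral_inner_eq_of_periodic h hper hτ, intervalIntegral.integral_const_mul]
  congr 1
  refine intervalIntegral.integral_congr fun t _ => ?_
  exact gradNormSq_eq_toReal_eGradNormSq_holds (h.smooth_velocity.isSmooth_slice (mem_univ t))

/-- **No leak, with equality, for periodic classical solutions under a steady force**: for a
`τ`-periodic (`τ > 0`) global classical solution of `NS_ν` on `ℝ × T^d` forced by the steady `f`,
the `limsup` long-time average of the injected power equals the mean dissipation,
`⟨(f, u)⟩⁺ = ⟨ν‖∇u‖₂²⟩`, and so does every generalized long-time average `Λ⟨(f, u)⟩`: all three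
are the period average `τ⁻¹ ∫₀^τ (f, u) = τ⁻¹ ∫₀^τ ν‖∇u‖₂²` (Cheskidov 2023, §6; Doering–Foias
2002, §2). [folklore] -/
theorem longTimeAvg_inner_eq_meanDissipation_of_periodic {ν : ℝ}
    {f : UnitAddTorus d → EuclideanSpace ℝ d} {u : ℝ → UnitAddTorus d → EuclideanSpace ℝ d}
    {p : ℝ → UnitAddTorus d → ℝ} (h : IsClassicalNSSolutionOn univ ν (fun _ => f) u p) {τ : ℝ}
    (hper : Function.Periodic u τ) (hτ : 0 < τ) :
    longTimeAvgSup (fun t => ∫ x, ⟪f x, u t x⟫) = meanDissipation ν u ∧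
      ∀ Λ : GeneralizedLimit, Λ.longTimeAvg (fun t => ∫ x, ⟪f x, u t x⟫) = meanDissipation ν u := by
  have hg : Function.Periodic (fun t => ∫ x, ⟪f x, u t x⟫) τ := fun t => by
    simp only [hper t]
  have hW := intervalIntegral_inner_eq_dissipation_of_periodic h hper hτ.le
  have hwork : τ⁻¹ * ∫ t in (0 : ℝ)..τ, ∫ x, ⟪f x, u t x⟫ = meanDissipation ν u := by
    rw [meanDissipation_eq_of_periodic hper hτ, ← hW]
  refine ⟨?_, fun Λ => ?_⟩
  · rw [longTimeAvgSup_eq_of_periodic hg hτ, hwork]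
  · rw [Λ.longTimeAvg_eq_of_periodic hg hτ, hwork]

end PeriodicDriftBookkeeping

/-- **Registered stub `stub_periodicDriftBookkeeping`** of the line `laminar-burst-shadowing` (crux
`DopplerClock.QuadratureStressFloor`, stmt-AnomalousDissipation-18129): a `τ`-periodic (`τ > 0`)
global classical solution `(u, p)` of `NS_ν` (`ν > 0`) on `ℝ × 𝕋³` under a steady force `f` is a
global Leray–Hopf solution from `u 0` (Robinson–Rodrigo–Sadowski 2016, Thm. 6.5), has
`sup_{t ≥ 0} ½‖u(t)‖₂² < ∞` (continuity and periodicity of the energy), satisfies the no-leak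
clause with equality `⟨(f, u)⟩⁺ = ⟨ν‖∇u‖₂²⟩`, and every generalized limit gives the injection the
same value `Λ⟨(f, u)⟩ = ⟨ν‖∇u‖₂²⟩` (energy equality over one period; long-time averages of
periodic observables are period averages — Doering–Foias 2002, §2; Cheskidov 2023, §6). The
hypothesis `0 < ν` is not used. [folklore] -/
theorem stub_periodicDriftBookkeeping :
    ∀ (ν τ : ℝ) (f : UnitAddTorus (Fin 3) → EuclideanSpace ℝ (Fin 3))
      (u : ℝ → UnitAddTorus (Fin 3) → EuclideanSpace ℝ (Fin 3)) (p : ℝ → UnitAddTorus (Fin 3) → ℝ),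
      0 < ν → 0 < τ →
      Literature.Analysis.FunctionSpaces.Torus.IsClassicalNSSolutionOn Set.univ ν (fun _ => f) u p →
      Function.Periodic u τ →
      Literature.Analysis.FluidPDE.Torus.IsGlobalLerayHopf ν (fun _ => f) (u 0) u ∧
      (∃ C : ℝ, ∀ t : ℝ, 0 ≤ t → Literature.Analysis.FunctionSpaces.Torus.kineticEnergy (u t) ≤ C) ∧
      Literature.Analysis.FluidPDE.longTimeAvgSup (fun t => ∫ x, inner ℝ (f x) (u t x)) =
        Literature.Analysis.FluidPDE.meanDissipation ν u ∧
      ∀ Λ : Literature.Analysis.FluidPDE.GeneralizedLimit,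
        Λ.longTimeAvg (fun t => ∫ x, inner ℝ (f x) (u t x)) =
          Literature.Analysis.FluidPDE.meanDissipation ν u := by
  intro ν τ f u p _hν hτ h hper
  obtain ⟨C, hC⟩ := PeriodicDriftBookkeeping.exists_kineticEnergy_le h.smooth_velocity hper hτ
  obtain ⟨hsup, hΛ⟩ :=
    PeriodicDriftBookkeeping.longTimeAvg_inner_eq_meanDissipation_of_periodic h hper hτ
  exact ⟨h.isGlobalLerayHopf, ⟨C, fun t _ => hC t⟩, hsup, hΛ⟩

end Summit.AnomalousDissipation.AnomalousDissipation.Theorems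

end
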